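import Mathlib
import HarnessLib
import Summits.NavierStokesRegularity.NavierStokesRegularity.Theses.IsobarTomography
import Literature.Analysis.FluidPDE.NSBoundedMildAnalytic

/-!
# Line `Sketch` for crux `IsobarTomography.TubeAlternative` (stmt-NavierStokesRegularity-11739)
# — lead prover's registered skeleton

Source line: crux workfile `Cruxes/TubeAlternative/SketchIdeator2.lean` (ideator 2, round 1; evidence
`20260816T111531Z-Sketch.lean`, sha 944224981af6040e), card `analytic-continuation-isobaric-defect`.
The body below is that sketch verbatim (namespace renamed `…Cruxes.TubeAlternative.Sketch`), followed by the
two registered stubs and the composition `TubeAlternative_of` concluding the route decl BY NAME.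

## Registered stubs (2)

* `stub_DefectAnalytic` (L1, card: "provable now, M") — joint real-analyticity of the isobaric defect
  `F = ⟪curl v, ∇q⟫` of a KNSS limit with classical pressure.
* `stub_LocalTomographicSelection` (L3, the bet, HARDEST, the lead's) — under the crux's antecedent, some KNSS
  limit with classical pressure has a vanishing GERM of `F` at one interior point and is not slice-constant.

`TubeAlternative_of : Theses.IsobarTomography.TubeAlternative` is `tubeAlternative_of_local` applied to the stubs.

Disproof honoured: none exists for this crux at registration time (payload `disproof_path` absent; `ledger crux ls`
shows no `Disproof.lean`).
-/

set_option linter.dupNamespace false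

noncomputable section

namespace Summit.NavierStokesRegularity.NavierStokesRegularity.Cruxes.TubeAlternative.Sketch

open Set Filter Topology
open Literature.Analysis.FluidPDE
open Summit.NavierStokesRegularity.NavierStokesRegularity.Theses.IsobarTomography

/-- Physical space. -/
local notation "E3" => EuclideanSpace ℝ (Fin 3)

/-! ## Card A — analytic continuation of the isobaric defect -/

/-- The ISOBARIC DEFECT of a velocity/pressure pair as a function on space–time:
`F(s, y) = ⟪curl v(s) y, ∇q(s) y⟫ = |ω| ∂_ξ q` — the pseudoscalar whose vanishing is the crux's
"isobaric vortex lines" clause. -/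
def isobaricDefect (v : ℝ → E3 → E3) (q : ℝ → E3 → ℝ) : ℝ × E3 → ℝ :=
  fun z => inner ℝ (curl (v z.1) z.2) (gradient (q z.1) z.2)

/-- **L1 (provable now, size M).** The isobaric defect of a KNSS blow-up limit carrying a classical
pressure is jointly real-analytic on `(-∞,0) × ℝ³`. Source: `lemarieRieusset2016_local_analyticity_holds`
(PROVED in tree: the bounded mild solution from an `L^∞` datum is `AnalyticOnNhd ℝ` jointly in
`(t,x)` on windows of length `ε/M²`; a bounded ancient mild solution restarts at every `s < 0` with the
same bound `M = 1`, windows cover `(-∞,0)`, `oseenMild_essBounded_unique` + smoothness identify it with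
`v` pointwise); then `curl v` and `∇q = Δv − ∂ₛv − (v·∇)v` are analytic (derivatives/products of
analytic maps), hence so is `F`. -/
def DefectAnalytic : Prop :=
  ∀ (v : ℝ → E3 → E3) (q : ℝ → E3 → ℝ), IsKNSSBlowupLimit v →
    IsClassicalNSSolutionOn (Iio 0) 1 0 v q →
    AnalyticOnNhd ℝ (isobaricDefect v q) (Iio (0 : ℝ) ×ˢ (univ : Set E3))

/-- **L2 (identity theorem, PROVED).** If the isobaric defect is real-analytic on the (convex, hence
preconnected) slab `(-∞,0) × ℝ³` and vanishes on a neighbourhood of ONE space–time point, then the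
vortex lines are isobaric everywhere on `(-∞,0) × ℝ³` — exactly the crux's third conjunct. -/
theorem isobaric_of_germ {v : ℝ → E3 → E3} {q : ℝ → E3 → ℝ}
    (hA : AnalyticOnNhd ℝ (isobaricDefect v q) (Iio (0 : ℝ) ×ˢ (univ : Set E3)))
    {z₀ : ℝ × E3} (hz₀ : z₀.1 < 0) (hgerm : isobaricDefect v q =ᶠ[𝓝 z₀] 0) :
    ∀ t < 0, ∀ x : E3, inner ℝ (curl (v t) x) (gradient (q t) x) = 0 := by
  have hpre : IsPreconnected (Iio (0 : ℝ) ×ˢ (univ : Set E3)) :=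
    ((convex_Iio (0 : ℝ)).prod convex_univ).isPreconnected
  have hz : z₀ ∈ Iio (0 : ℝ) ×ˢ (univ : Set E3) := ⟨hz₀, mem_univ _⟩
  have h := hA.eqOn_zero_of_preconnected_of_eventuallyEq_zero hpre hz hgerm
  intro t ht x
  have hx : ((t, x) : ℝ × E3) ∈ Iio (0 : ℝ) ×ˢ (univ : Set E3) := ⟨ht, mem_univ _⟩
  simpa [isobaricDefect] using h hx

/-- Mathlib-level lemma (PROVED): a real-analytic function all of whose iterated derivatives vanish at
a point vanishes on a neighbourhood of that point (Taylor expansion on the ball of convergence). -/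
theorem eventuallyEq_zero_of_jets {F : ℝ × E3 → ℝ} {z₀ : ℝ × E3} (hF : AnalyticAt ℝ F z₀)
    (hjet : ∀ n : ℕ, iteratedFDeriv ℝ n F z₀ = 0) : F =ᶠ[𝓝 z₀] 0 := by
  obtain ⟨p, r, hp⟩ := hF
  have hcoef : ∀ (n : ℕ) (y : ℝ × E3), p n (fun _ => y) = 0 := by
    intro n y
    have h := hp.factorial_smul y n
    rw [hjet n] at h
    simp only [zero_apply] at h
    exact (smul_eq_zero.mp h).resolve_left (Nat.factorial_ne_zero n)
  have hball : ∀ y ∈ Metric.eball (0 : ℝ × E3) r, F (z₀ + y) = 0 := by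
    intro y hy
    have hs := hp.hasSum hy
    simp only [hcoef] at hs
    exact (hs.unique hasSum_zero)
  have hmem : ∀ᶠ z in 𝓝 z₀, z - z₀ ∈ Metric.eball (0 : ℝ × E3) r := by
    have : (fun z => z - z₀) ⁻¹' Metric.eball (0 : ℝ × E3) r ∈ 𝓝 z₀ := by
      apply (continuous_id.sub continuous_const).continuousAt.preimage_mem_nhds
      simpa using Metric.eball_mem_nhds (0 : ℝ × E3) hp.r_pos
    exact this
  filter_upwards [hmem] with z hz
  have := hball (z - z₀) hz
  simpa using this

/-- Infinite-jet variant of L2 (PROVED): vanishing of the defect to infinite order at ONE point of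
the slab already forces global isobaricity. This is the form matching the one-point nature of the
`¬blob` information. -/
theorem isobaric_of_infinite_jet {v : ℝ → E3 → E3} {q : ℝ → E3 → ℝ}
    (hA : AnalyticOnNhd ℝ (isobaricDefect v q) (Iio (0 : ℝ) ×ˢ (univ : Set E3)))
    {z₀ : ℝ × E3} (hz₀ : z₀.1 < 0)
    (hjet : ∀ n : ℕ, iteratedFDeriv ℝ n (isobaricDefect v q) z₀ = 0) :
    ∀ t < 0, ∀ x : E3, inner ℝ (curl (v t) x) (gradient (q t) x) = 0 :=
  isobaric_of_germ hA hz₀ (eventuallyEq_zero_of_jets (hA z₀ ⟨hz₀, mem_univ _⟩) hjet)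

/-- The crux's antecedent packaged (verbatim hypotheses of `TubeAlternative`). -/
def Antecedent (ν T : ℝ) (u : ℝ → E3 → E3) (p : ℝ → E3 → ℝ) : Prop :=
  0 < ν ∧ 0 < T ∧ IsMaximalSmoothSolution ν 0 u p T ∧ IsLerayHopfOn T ν 0 (u 0) u ∧
    HasRapidSpatialDecay (u 0) ∧ IsTypeIBlowup u T ∧
    ¬ ∃ κ : ℝ, 0 < κ ∧ ∃ Ω : ℝ → ℝ, ∃ t₀ ∈ Set.Ico 0 T, ∀ t ∈ Set.Ico t₀ T,
      (∃ x : E3, Ω t < ‖curl (u t) x‖) ∧ ∀ x : E3, Ω t < ‖curl (u t) x‖ →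
        κ * ‖curl (u t) x‖ ^ 2 * Laplacian.laplacian (p t) x ≤
          iteratedFDeriv ℝ 2 (p t) x ![curl (u t) x, curl (u t) x]

/-- **L3 (the bet — LOCALISED tomographic selection).** At a Type-I singularity where the blob
hypothesis fails, SOME KNSS blow-up limit with classical pressure has its isobaric defect vanishing on
a neighbourhood of ONE space–time point (equivalently, by L2', to infinite order at one point), and is
not slice-wise constant (the latter is Type-I bookkeeping: Leray's lower bound makes `s_∞` finite, which
kills constant limits). Only local/core information is demanded; the far field is irrelevant. -/
def LocalTomographicSelection : Prop :=
  ∀ (ν T : ℝ) (u : ℝ → E3 → E3) (p : ℝ → E3 → ℝ), Antecedent ν T u p →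
    ∃ (v : ℝ → E3 → E3) (q : ℝ → E3 → ℝ), IsKNSSBlowupLimit v ∧
      IsClassicalNSSolutionOn (Iio 0) 1 0 v q ∧
      (∃ z₀ : ℝ × E3, z₀.1 < 0 ∧ isobaricDefect v q =ᶠ[𝓝 z₀] 0) ∧
      ¬ (∀ t < 0, ∃ b : E3, v t = fun _ => b)

/-! ## Registered stubs of line `Sketch` and the composition concluding the crux BY NAME -/

/-- **Stub L1 (`DefectAnalytic`).** The isobaric defect of a KNSS blow-up limit carrying a classical
pressure is jointly real-analytic on the slab `(-∞,0) × ℝ³` (card: Lemarié-Rieusset 2016 Thm 9.12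
restarted at every `s < 0` + `oseenMild_essBounded_unique`). -/
theorem stub_DefectAnalytic : DefectAnalytic := by
  sorry

/-- **Stub L3 (`LocalTomographicSelection`, the bet).** Under the crux's antecedent some KNSS
blow-up limit with classical pressure has isobaric defect vanishing near ONE space–time point and is
not slice-wise constant. -/
theorem stub_LocalTomographicSelection : LocalTomographicSelection := by
  sorry

/-- **Composition (the registered skeleton).** The two stubs give the crux `TubeAlternative` BY NAME:
from L3 take the limit `(v,q)` with a vanishing germ of the defect, from L1 its analyticity on the slab,
and globalise with the identity theorem `isobaric_of_germ`. -/
theorem TubeAlternative_of : TubeAlternative := by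
  intro ν T hν hT u p hmax hLH hdec hI hnb
  obtain ⟨v, q, hv, hcl, ⟨z₀, hz₀, hgerm⟩, hnc⟩ :=
    stub_LocalTomographicSelection ν T u p ⟨hν, hT, hmax, hLH, hdec, hI, hnb⟩
  exact ⟨v, q, hv, hcl, isobaric_of_germ (stub_DefectAnalytic v q hv hcl) hz₀ hgerm, hnc⟩

/-! ## The rest of the ideator's sketch (jet/ladder forms, card B)

The ideator's compositions with named hypotheses (`tubeAlternative_of_local`, `tubeAlternative_of_jet`,
both sorry-free in `Cruxes/TubeAlternative/SketchIdeator2.lean`) are omitted here so that `TubeAlternative_of`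
is the only theorem concluding the crux (skeleton registration); the jet form composes identically via
`isobaric_of_infinite_jet`. -/

/-- **L3' (jet form of the bet).** Some KNSS limit has its isobaric defect vanishing to INFINITE ORDER
at ONE interior space–time point (plus Type-I non-constancy). -/
def JetTomographicSelection : Prop :=
  ∀ (ν T : ℝ) (u : ℝ → E3 → E3) (p : ℝ → E3 → ℝ), Antecedent ν T u p →
    ∃ (v : ℝ → E3 → E3) (q : ℝ → E3 → ℝ), IsKNSSBlowupLimit v ∧
      IsClassicalNSSolutionOn (Iio 0) 1 0 v q ∧
      (∃ z₀ : ℝ × E3, z₀.1 < 0 ∧ ∀ n : ℕ, iteratedFDeriv ℝ n (isobaricDefect v q) z₀ = 0) ∧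
      ¬ (∀ t < 0, ∃ b : E3, v t = fun _ => b)

/-- **Finite-order ladder (the compactness face of card A).** `VanishesToOrder F z m`: all iterated
derivatives of order `< m` vanish at `z`. -/
def VanishesToOrder (F : ℝ × E3 → ℝ) (z : ℝ × E3) (m : ℕ) : Prop :=
  ∀ n < m, iteratedFDeriv ℝ n F z = 0

/-- **L3ₘ (rung `m` of the ladder).** For every `m`, some KNSS limit of the Type-I hull has, at some
interior point, isobaric defect vanishing to order `m`. Upper semicontinuity of the vanishing order
under `C^∞_loc` convergence and compactness of the hull (KNSS §4 / `SuitableCompactness_holds`) turn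
`∀ m, L3ₘ` into the infinite-jet form of L3 for ONE limit and ONE point. Each rung is a finite system
of polynomial identities in the Taylor jets of `(v, q)` at a point. -/
def LadderRung (m : ℕ) : Prop :=
  ∀ (ν T : ℝ) (u : ℝ → E3 → E3) (p : ℝ → E3 → ℝ), Antecedent ν T u p →
    ∃ (v : ℝ → E3 → E3) (q : ℝ → E3 → ℝ), IsKNSSBlowupLimit v ∧
      IsClassicalNSSolutionOn (Iio 0) 1 0 v q ∧
      ∃ z₀ : ℝ × E3, z₀.1 < 0 ∧ VanishesToOrder (isobaricDefect v q) z₀ m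

/-! ## Card B — Morse–Bott ladder at pressure-critical points -/

/-- **M1 (calculus, provable now, S).** At a critical point `x` of the pressure slice `q`, the
derivative of the slice defect `y ↦ ⟪w y, ∇q y⟫` is `h ↦ ⟪w x, D(∇q)(x) h⟫ = ∇²q(x)(w x, h)`:
the first rung above the free one is "vorticity in the kernel of the pressure Hessian". -/
def DefectFDerivAtCritical : Prop :=
  ∀ (w : E3 → E3) (q : E3 → ℝ) (x : E3), ContDiff ℝ 1 w → ContDiff ℝ 2 q → gradient q x = 0 →
    HasFDerivAt (fun y => inner ℝ (w y) (gradient q y))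
      ((innerSL ℝ (w x)).comp (fderiv ℝ (gradient q) x)) x

/-- **M2 (no nondegenerate pressure minima in isobaric flows, provable now, S).** If the slice defect
vanishes near a critical point `x` of `q` at which the Hessian is positive definite, and the pressure
Poisson inequality `Δq(x) ≤ ½|curl v(x)|²` holds there (it is `Δq = ½|ω|² − |S|²` for a classical NS
pair), contradiction: `∇F(x) = ∇²q(x)·ω(x) = 0` forces `ω(x) = 0`, whence `tr ∇²q(x) = Δq(x) ≤ 0`,
against positive definiteness. Isobaric flows live in the TUBE world: every local pressure minimum is
Morse–Bott degenerate. -/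
def NoNondegeneratePressureMin : Prop :=
  ∀ (w : E3 → E3) (q : E3 → ℝ) (x : E3), ContDiff ℝ 1 w → ContDiff ℝ 2 q →
    (∀ᶠ y in 𝓝 x, inner ℝ (w y) (gradient q y) = 0) → gradient q x = 0 →
    (∀ h : E3, h ≠ 0 → 0 < iteratedFDeriv ℝ 2 q x ![h, h]) →
    Laplacian.laplacian q x ≤ (1 / 2) * ‖w x‖ ^ 2 → False

/-- **M3 (anti-blob at a pressure-critical vorticity peak ⇒ rung 2, provable now, S).** If `∇q(x)=0`,
the Hessian is positive SEMI-definite at `x` (local minimum) and the crux's anti-blob sign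
`∇²q(x)(ω,ω) ≤ 0` holds, then `∇²q(x)·ω = 0`, i.e. the slice defect has vanishing derivative at `x`
(PSD + `ξᵀPξ ≤ 0` ⇒ `Pξ = 0`). -/
def RungTwoOfAntiBlob : Prop :=
  ∀ (w : E3 → E3) (q : E3 → ℝ) (x : E3), ContDiff ℝ 1 w → ContDiff ℝ 2 q → gradient q x = 0 →
    (∀ h : E3, 0 ≤ iteratedFDeriv ℝ 2 q x ![h, h]) →
    iteratedFDeriv ℝ 2 q x ![w x, w x] ≤ 0 →
    fderiv ℝ (fun y => inner ℝ (w y) (gradient q y)) x = 0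


end Summit.NavierStokesRegularity.NavierStokesRegularity.Cruxes.TubeAlternative.Sketch

end
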